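import Summits.Parity.GeneralizedHardyLittlewood.Theorems.BeyondDiagonalBeatsQuarter.OffDiagHeartPieces
import Summits.Parity.GeneralizedHardyLittlewood.Theorems.BeyondDiagonalBeatsQuarter.OffDiagCoreSplit
import Summits.Parity.GeneralizedHardyLittlewood.Theorems.BeyondDiagonalBeatsQuarter.OffDiagPrincipalShort
import HarnessLib

/-!
# Route `PrimeLevelFamEdge`, crux K_B (stmt-Parity-20343), line `diagonal_kernel_split` rev 4, plan Ω,
# **L9″ (instantiated) — the heart from the a8 split of the finite dual core: `stub ⇐ {A8P-funded part of coreP,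
# coreL (large conductors, L7d), coreX (doubly non-unit stratum)} funded ∧ {coreS (small conductors) + U} residual**

`OffDiagHeartPieces.offDiagBelowSlack_io_of_pieces_coreHeight` (p651080) with the pieces of `OffDiagCoreSplit`
(`sum_offDiagCore_eq_coreP_add_coreS_add_coreL_add_coreX`, prover-6) at `G = goodPrimes Δ′ N`, `Hf = coreHeight ε₀`
(K1, prover-3) and a conductor cut-off `R = Rf Δ′ N ≥ 1` chosen by the consumer:

* `prime_and_forty_le_of_mem_goodPrimes` — for `N ≥ 40` every good prime of the block `(N, 2N]` is a prime `≥ 40`;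
* `boxWeight_eq_zero_of_degenerate` — `Φ_i ≡ 0` if one of `d₁, d₂, α, β, c` vanishes (junk parameters);
* **`summable_fourier2_boxWeight_intShift`** — the shifted-lattice summability hypothesis `hsum` of the CoreSplit identity,
  DISCHARGED for every parameter tuple (`OffDiagPrincipalShort.summable_fourier2_intShift` on the smooth compactly supported
  box weight; the degenerate tuples give the zero function);
* **`sum_offDiagCore_goodPrimes_eq_pieces`** — the CoreSplit identity on the block of good primes, hypothesis-free for
  `N ≥ 40`, `Δ′ ∈ (0, 2]`, `R ≥ 1`;
* **`offDiagBelowSlack_io_of_coreSplit`** — `stub_offDiagBelowSlack_io` VERBATIM from: a split `coreP = FP + U` on the good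
  primes, `FP`/`coreL_{Rf}`/`coreX` each eventually `≤ ε·Σms` (every `ε > 0`), and the clean-scale residual block bound for
  `coreS_{Rf} + U` with some `U′ < 4(Δ′−1)/Δ′` (`c₀′`-first shell).

So the heart is KERNEL MODULO exactly {A8P (the funded part of `coreP`), L7d (`coreL`), the `coreX` bound} — all keyed —
and the displayed research-grade residual `(S) + (U)` (TRANSITION-SIZING §8–§9). Helper; closes nothing; no definitions;
standard axioms. «The programme SEARCHES and TYPES; no claim about Landau–Siegel zeros, Theorems 1–2 of
arXiv:2211.02515 or a repaired Margin232 until a kernel theorem says so.»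
-/

noncomputable section

open Finset Polynomial
open scoped Real ContDiff

namespace Summit.Parity.GeneralizedHardyLittlewood.Theorems.BeyondDiagonalBeatsQuarter.OffDiag

open Literature.NumberTheory.LFunctions Literature.NumberTheory.LFunctions.KMV2000
open Literature.NumberTheory.Sieve.FriedlanderIwaniecPrimes (fourier2)
open Literature.Analysis.FunctionSpaces (besselJ besselJ_succ_apply_zero)
open PeterssonSplit (offDiag)

/-! ### The block of good primes is a block of primes `≥ 40` -/

/-- For `N ≥ 40` every good prime of the block `(N, 2N]` is a prime `≥ 40`. [folklore] -/
theorem prime_and_forty_le_of_mem_goodPrimes {Δ' : ℝ} {N : ℕ} (hN : 40 ≤ N) :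
    ∀ q ∈ goodPrimes Δ' N, q.Prime ∧ 40 ≤ q := by
  intro q hq
  obtain ⟨h1, -, hp, -⟩ := mem_goodPrimes_iff.mp hq
  exact ⟨hp, by omega⟩

/-! ### The shifted-lattice summability of the box transforms (discharging `hsum`) -/

/-- **Degenerate parameters give the zero box weight**: if `d₁ = 0`, `d₂ = 0`, `α = 0`, `β = 0` or `c = 0` then
`Φ_i ≡ 0` (`0^{−1/2} = 0`, `J₁(0) = 0`, `0⁻¹ = 0`). [folklore] -/
theorem boxWeight_eq_zero_of_degenerate (q : ℕ) {d₁ d₂ α β c : ℕ} (h : d₁ = 0 ∨ d₂ = 0 ∨ α = 0 ∨ β = 0 ∨ c = 0)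
    (i : ℕ × ℕ) (y₁ y₂ : ℝ) : boxWeight q d₁ d₂ α β c i y₁ y₂ = 0 := by
  have hW : layerWeightR q d₁ d₂ α β c (y₁, y₂) = 0 := by
    rw [layerWeightR]
    dsimp only
    rcases h with h | h | h | h | h
    · subst h
      simp
    · subst h
      simp
    · subst h
      simp [besselJ_succ_apply_zero]
    · subst h
      simp [besselJ_succ_apply_zero]
    · subst h
      simp
  rw [boxWeight, hW, Complex.ofReal_zero, mul_zero]

/-- **The `hsum` hypothesis of the CoreSplit identity, discharged**: for a level `q ≥ 1` and ANY parameters,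
`s ↦ Φ̂_{q,d,α,β,c,i}(ξ₁, s/h₁ + τ)` is summable (`h₁ ≠ 0`). [folklore] -/
theorem summable_fourier2_boxWeight_intShift (q : ℕ) [NeZero q] (d₁ d₂ α β c : ℕ) (i : ℕ × ℕ) (ξ₁ τ : ℝ) {h₁ : ℤ}
    (hh : h₁ ≠ 0) : Summable (fun s : ℤ ↦ fourier2 (boxWeight q d₁ d₂ α β c i) ξ₁ ((s : ℝ) / h₁ + τ)) := by
  by_cases hdeg : d₁ = 0 ∨ d₂ = 0 ∨ α = 0 ∨ β = 0 ∨ c = 0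
  · have h0 : boxWeight q d₁ d₂ α β c i = fun _ _ ↦ 0 := by
      funext y₁ y₂; exact boxWeight_eq_zero_of_degenerate q hdeg i y₁ y₂
    have hΦ : ContDiff ℝ ∞ (Function.uncurry (boxWeight q d₁ d₂ α β c i)) := by
      rw [h0]; exact contDiff_const
    have hΦc : HasCompactSupport (Function.uncurry (boxWeight q d₁ d₂ α β c i)) := by
      rw [h0]
      exact HasCompactSupport.intro isCompact_empty fun p _ ↦ rfl
    exact summable_fourier2_intShift hΦ hΦc hh τ ξ₁
  · push Not at hdeg
    obtain ⟨hd₁, hd₂, hα, hβ, -⟩ := hdeg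
    exact summable_fourier2_intShift
      (contDiff_uncurry_boxWeight (Nat.one_le_iff_ne_zero.mpr hd₁) (Nat.one_le_iff_ne_zero.mpr hd₂)
        (Nat.one_le_iff_ne_zero.mpr hα) (Nat.one_le_iff_ne_zero.mpr hβ) i)
      (hasCompactSupport_uncurry_boxWeight i) hh τ ξ₁

/-- **The CoreSplit identity on a block of good primes, hypothesis-free**: for `N ≥ 40`, `0 < Δ′ ≤ 2`, `R ≥ 1` and any
height `Hf`, `Σ_{q ∈ goodPrimes Δ′ N} offDiagCore Hf Δ′ q = coreP + coreS_R + coreL_R + coreX` (at `G = goodPrimes Δ′ N`).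
[cite: KowalskiMichelVanderKam2000, §6 p. 19, (21)–(23) p. 12 — derivation; Davenport1980, ch. 29 — derivation] -/
theorem sum_offDiagCore_goodPrimes_eq_pieces {N : ℕ} (hN : 40 ≤ N) {Δ' : ℝ} (h0 : 0 < Δ') (h2 : Δ' ≤ 2) {R : ℕ}
    (hR : 1 ≤ R) (Hf : ℕ → ℕ → ℕ → ℕ → ℕ → ℕ → ℕ × ℕ → ℕ) :
    ∑ q ∈ goodPrimes Δ' N, offDiagCore Hf Δ' q =
      coreP (goodPrimes Δ' N) Hf Δ' + coreS R (goodPrimes Δ' N) Hf Δ' + coreL R (goodPrimes Δ' N) Hf Δ' +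
        coreX (goodPrimes Δ' N) Hf Δ' := by
  refine sum_offDiagCore_eq_coreP_add_coreS_add_coreL_add_coreX (goodPrimes Δ' N)
    (prime_and_forty_le_of_mem_goodPrimes hN) h0 h2 hR Hf fun q hq d₁ d₂ α β c i ξ₁ τ h₁ hh ↦ ?_
  haveI : NeZero q := ⟨(mem_goodPrimes_iff.mp hq).2.2.1.ne_zero⟩
  exact summable_fourier2_boxWeight_intShift q d₁ d₂ α β c i ξ₁ τ hh

/-! ### The heart from the a8 split -/

/-- **L9″ instantiated on the a8 split of the finite dual core.** For `ε₀ ∈ (0,1]`, a conductor cut-off `Rf Δ′ N ≥ 1`, a split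
`coreP = FP + U` on the good primes (`Δ′ ∈ (1,2)`), the three FUNDED inputs — `FP` (A8P), `coreL_{Rf}` (L7d, large conductors),
`coreX` (doubly non-unit stratum), each eventually `≤ ε·Σ ms` for every `ε > 0` — and the clean-scale residual block bound for
`coreS_{Rf} + U` with SOME tolerance `U′ < 4(Δ′−1)/Δ′` (`c₀′`-first shell), `stub_offDiagBelowSlack_io` holds VERBATIM.
[cite: MontgomeryVaughan2007, Cor. 11.10 (Page); KowalskiMichelVanderKam2000, §6 p. 19 — derivation] -/
theorem offDiagBelowSlack_io_of_coreSplit {ε₀ : ℝ} (hε₀ : 0 < ε₀) (hε₁ : ε₀ ≤ 1) (Rf : ℝ → ℕ → ℕ)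
    (hRf : ∀ (Δ' : ℝ) (N : ℕ), 1 ≤ Rf Δ' N) (FP U : ℝ → ℕ → ℝ)
    (hPsplit : ∀ Δ' : ℝ, 1 < Δ' → Δ' < 2 → ∀ N : ℕ,
      coreP (goodPrimes Δ' N) (coreHeight ε₀) Δ' = FP Δ' N + U Δ' N)
    (hFP : ∀ Δ' : ℝ, 1 < Δ' → Δ' < 2 → ∀ ε : ℝ, 0 < ε → ∃ N₀ : ℕ, ∀ N : ℕ, N₀ ≤ N →
      FP Δ' N ≤ ε * ∑ q ∈ goodPrimes Δ' N, mainScaleReal Δ' q)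
    (hL : ∀ Δ' : ℝ, 1 < Δ' → Δ' < 2 → ∀ ε : ℝ, 0 < ε → ∃ N₀ : ℕ, ∀ N : ℕ, N₀ ≤ N →
      coreL (Rf Δ' N) (goodPrimes Δ' N) (coreHeight ε₀) Δ' ≤ ε * ∑ q ∈ goodPrimes Δ' N, mainScaleReal Δ' q)
    (hX : ∀ Δ' : ℝ, 1 < Δ' → Δ' < 2 → ∀ ε : ℝ, 0 < ε → ∃ N₀ : ℕ, ∀ N : ℕ, N₀ ≤ N →
      coreX (goodPrimes Δ' N) (coreHeight ε₀) Δ' ≤ ε * ∑ q ∈ goodPrimes Δ' N, mainScaleReal Δ' q)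
    (hR : ∀ c₀' : ℝ, 0 < c₀' → ∃ b : ℝ, 1 < b ∧ ∀ Δ' : ℝ, 1 < Δ' → Δ' < b →
      ∃ U' : ℝ, U' < 4 * (Δ' - 1) / Δ' ∧ ∃ a₀ : ℝ, 0 < a₀ ∧ ∃ η' : ℝ, 0 < η' ∧ η' < c₀' / a₀ ∧
        ∃ N₀ : ℕ, ∀ N : ℕ, N₀ ≤ N → CleanScale a₀ η' N →
          coreS (Rf Δ' N) (goodPrimes Δ' N) (coreHeight ε₀) Δ' + U Δ' N ≤
            U' * ∑ q ∈ goodPrimes Δ' N, mainScaleReal Δ' q) :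
    ∃ b : ℝ, 1 < b ∧ ∀ Δ' : ℝ, 1 < Δ' → Δ' < b → ∃ U : ℝ, U < 4 * (Δ' - 1) / Δ' ∧
      ∀ q₀ : ℕ, ∃ q : ℕ, ∃ _ : NeZero q, q₀ ≤ q ∧ q.Prime ∧
        (∀ n : ℕ, (n : ℝ) ≠ qhat q ^ Δ') ∧
          -(∑ l ∈ Icc 1 ⌊qhat q ^ Δ'⌋₊, ∑ m ∈ Icc 1 ⌊qhat q ^ Δ'⌋₊,
              ((mollifierCoeff (X ^ 2) (qhat q ^ Δ') l * mollifierCoeff (X ^ 2) (qhat q ^ Δ') m : ℝ) : ℂ) *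
                offDiag q l m).re ≤ U * mainScaleReal Δ' q :=
  offDiagBelowSlack_io_of_pieces_coreHeight hε₀ hε₁
    (fun Δ' N ↦ coreP (goodPrimes Δ' N) (coreHeight ε₀) Δ')
    (fun Δ' N ↦ coreS (Rf Δ' N) (goodPrimes Δ' N) (coreHeight ε₀) Δ')
    (fun Δ' N ↦ coreL (Rf Δ' N) (goodPrimes Δ' N) (coreHeight ε₀) Δ')
    (fun Δ' N ↦ coreX (goodPrimes Δ' N) (coreHeight ε₀) Δ') FP U
    (fun Δ' h1 h2 ↦ ⟨40, fun N hN ↦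
      sum_offDiagCore_goodPrimes_eq_pieces hN (lt_trans zero_lt_one h1) h2.le (hRf Δ' N) (coreHeight ε₀)⟩)
    hPsplit hFP hL hX hR

end Summit.Parity.GeneralizedHardyLittlewood.Theorems.BeyondDiagonalBeatsQuarter.OffDiag

end
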